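import Mathlib
import Literature.ModelTheory.FiniteModelTheory.SymmetricCircuitCountingWidthProofs
import Summits.PneNP.PneNP.Theorems.ConvexRankGatesConvexGateBlindAffineCodimension

/-!
# PneNP / ConvexRankGates — `ConvexGateBlind`: affine column objects — eventual forms (every `δ ∈ (0,1)`)

Helpers (`--supports stmt-PneNP-10680`), COLUMN-SPACE line (prover seat 2, session 24): the crux-shaped corollaries of
`affine_terms_lower_bound` (`C(m,k) ≤ R` for affine column objects) and `affine_codim_terms_lower_bound`
(`C(m,k) ≤ (R+1)^{p+1}` for column objects of affine defect `≤ p`), with `k = ⌈m^δ⌉₊`.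

* `eventually_rpow_mul_rpow_lt_choose` — the count: for `0 < δ' < δ < 1` and every `C`, eventually
  `m^{C·m^{δ'}} < 2^k ≤ C(m,k)` (`2k ≤ m`, `2^k ≤ C(m,k)` — `two_pow_le_choose_of_two_mul_le`; `C m^{δ'} log m < m^δ log 2` since `log m = o(m^{δ−δ'})`).
* `lpSlice_affine_columns` — **for EVERY `δ ∈ (0,1)` and every `c`: eventually in `m`, for every `ε > 0`, NO factorisation
  `cdist Q u − ε = ∑_{l<R} U_l(u) V_l(Q)` with `R ≤ m^c`, `V_l ≥ 0` on `k`-sets and AFFINE column objects `U_l(u) = a_l − t_l(u)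
  ≥ 0` on `k`-clique-free graphs** (lift-free LP refutations of the crux do not exist, in the crux's quantifier order, in
  the whole range `δ < 1` — not only `δ < 1/2`).
* `lpSlice_affine_codim_rpow` — **quantitative codimension form: for `0 < δ' < δ < 1` and every `c`, eventually, for every
  `ε > 0`, `R ≤ m^c` and `p + 1 ≤ m^{δ'}`: no factorisation whose column objects have affine defect `≤ p`.** I.e. the column
  objects of a polynomial-size LP refutation span `≥ m^{δ−o(1)}` directions modulo the affine functions of the graph; with
  `…CodimensionQuantitative.lean` (row side: `≥ m^{(1−2δ)/2−o(1)}` directions modulo the column space) a cheap refutation is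
  polynomially far from restricted on BOTH sides.
* `sandwiched_polyhedron_facets_ge_choose`, `lpSlice_no_sandwiched_polyhedron` — polyhedral form: a polyhedron with `R`
  inequalities, all valid on `k`-clique-free graphs, contained in the `ε`-relaxation `{x : x(E(Q)) ≤ C(k,2) − ε ∀Q}` of the
  clique constraints has `R ≥ C(m,k)` (bare cliques violate facets; uniqueness); eventually none with `R ≤ m^c`. [new]
-/

set_option linter.dupNamespace false

namespace Summit.PneNP.PneNP.Theorems

open Finset Real Filter Literature.Computability.Complexity
open Summit.PneNP.PneNP.Cruxes.ConvexGateBlind.StrictRankConicCover (Edge cdist)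

noncomputable section

/-! ## Numerics -/

/-- For `0 < δ < 1`: eventually `2⌈m^δ⌉₊ ≤ m` and `3 ≤ ⌈m^δ⌉₊`. [folklore] -/
theorem eventually_two_mul_ceil_rpow_le {δ : ℝ} (hδ0 : 0 < δ) (hδ1 : δ < 1) :
    ∀ᶠ m : ℕ in atTop, 2 * ⌈(m : ℝ) ^ δ⌉₊ ≤ m ∧ 3 ≤ ⌈(m : ℝ) ^ δ⌉₊ := by
  have hx : Tendsto (fun m : ℕ => (m : ℝ) ^ δ) atTop atTop :=
    (tendsto_rpow_atTop hδ0).comp tendsto_natCast_atTop_atTop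
  have hceil : Tendsto (fun m : ℕ => ⌈(m : ℝ) ^ δ⌉₊) atTop atTop := tendsto_nat_ceil_atTop.comp hx
  have hy : Tendsto (fun m : ℕ => (m : ℝ) ^ (1 - δ)) atTop atTop :=
    (tendsto_rpow_atTop (by linarith)).comp tendsto_natCast_atTop_atTop
  filter_upwards [hceil.eventually_ge_atTop 3, hy.eventually_ge_atTop 4, eventually_ge_atTop 4] with m h3 h4 hm4
  refine ⟨?_, h3⟩
  have hm0 : (0 : ℝ) < m := by exact_mod_cast (show 0 < m by omega)
  -- `m^δ · 4 ≤ m^δ · m^{1-δ} = m`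
  have hkey : (m : ℝ) ^ δ * 4 ≤ m := by
    calc (m : ℝ) ^ δ * 4 ≤ (m : ℝ) ^ δ * (m : ℝ) ^ (1 - δ) :=
          mul_le_mul_of_nonneg_left h4 (by positivity)
      _ = m := by rw [← Real.rpow_add hm0]; norm_num
  have hceil_le : (⌈(m : ℝ) ^ δ⌉₊ : ℝ) < (m : ℝ) ^ δ + 1 := Nat.ceil_lt_add_one (by positivity)
  have h2 : (2 * ⌈(m : ℝ) ^ δ⌉₊ : ℝ) ≤ m := by
    have hm4' : (4 : ℝ) ≤ m := by exact_mod_cast hm4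
    nlinarith
  exact_mod_cast h2

/-- For `0 < δ' < δ` and every `C`: eventually `C · m^{δ'} · log m < m^δ · log 2` (`log m = o(m^{δ−δ'})`). [folklore] -/
theorem eventually_mul_rpow_mul_log_lt {δ δ' : ℝ} (hδ' : δ' < δ) (C : ℝ) :
    ∀ᶠ m : ℕ in atTop, C * (m : ℝ) ^ δ' * Real.log m < (m : ℝ) ^ δ * Real.log 2 := by
  have hlog2 : 0 < Real.log 2 := Real.log_pos one_lt_two
  have ho := isLittleO_log_rpow_atTop (show 0 < δ - δ' by linarith)
  have hC : 0 < |C| + 1 := by positivity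
  have hbound := ho.bound (show 0 < Real.log 2 / (2 * (|C| + 1)) by positivity)
  have hnat := tendsto_natCast_atTop_atTop.eventually hbound
  filter_upwards [hnat, eventually_ge_atTop 2] with m hm hm2
  have hm1 : (1 : ℝ) < m := by exact_mod_cast hm2
  have hm0 : (0 : ℝ) < m := by linarith
  have hlogm : 0 < Real.log m := Real.log_pos hm1
  rw [Real.norm_of_nonneg hlogm.le, Real.norm_of_nonneg (by positivity)] at hm
  have hsplit : (m : ℝ) ^ δ = (m : ℝ) ^ δ' * (m : ℝ) ^ (δ - δ') := by
    rw [← Real.rpow_add hm0]; ring_nf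
  have hpos : 0 < (m : ℝ) ^ δ' := by positivity
  have hpos' : 0 < (m : ℝ) ^ (δ - δ') := by positivity
  calc C * (m : ℝ) ^ δ' * Real.log m ≤ |C| * (m : ℝ) ^ δ' * Real.log m := by
        have := le_abs_self C
        nlinarith [mul_pos hpos hlogm]
    _ ≤ (|C| + 1) * (m : ℝ) ^ δ' * Real.log m := by nlinarith [mul_pos hpos hlogm]
    _ ≤ (|C| + 1) * (m : ℝ) ^ δ' * (Real.log 2 / (2 * (|C| + 1)) * (m : ℝ) ^ (δ - δ')) := by
        exact mul_le_mul_of_nonneg_left hm (by positivity)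
    _ = (m : ℝ) ^ δ * Real.log 2 / 2 := by rw [hsplit]; field_simp
    _ < (m : ℝ) ^ δ * Real.log 2 := by
        have : 0 < (m : ℝ) ^ δ * Real.log 2 := by positivity
        linarith

/-- **The count.** For `0 < δ' < δ < 1` and every `C`: eventually `m^{C·m^{δ'}} < C(m, ⌈m^δ⌉₊)` (as reals). [folklore] -/
theorem eventually_rpow_mul_rpow_lt_choose {δ δ' : ℝ} (hδ0 : 0 < δ) (hδ1 : δ < 1) (hδ' : δ' < δ) (C : ℝ) :
    ∀ᶠ m : ℕ in atTop, (m : ℝ) ^ (C * (m : ℝ) ^ δ') < (m.choose ⌈(m : ℝ) ^ δ⌉₊ : ℝ) := by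
  filter_upwards [eventually_two_mul_ceil_rpow_le hδ0 hδ1, eventually_mul_rpow_mul_log_lt hδ' C, eventually_ge_atTop 2]
    with m hm hlog hm2
  obtain ⟨h2k, -⟩ := hm
  set k : ℕ := ⌈(m : ℝ) ^ δ⌉₊ with hk
  have hm0 : (0 : ℝ) < m := by exact_mod_cast (show 0 < m by omega)
  have hkge : (m : ℝ) ^ δ ≤ k := Nat.le_ceil _
  have hlog2 : 0 < Real.log 2 := Real.log_pos one_lt_two
  -- `m^{C m^{δ'}} = exp(C m^{δ'} log m) < exp(k log 2) = 2^k ≤ C(m,k)`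
  have h1 : (m : ℝ) ^ (C * (m : ℝ) ^ δ') < (2 : ℝ) ^ (k : ℝ) := by
    rw [Real.rpow_def_of_pos hm0, Real.rpow_def_of_pos two_pos, Real.exp_lt_exp]
    calc Real.log m * (C * (m : ℝ) ^ δ') = C * (m : ℝ) ^ δ' * Real.log m := by ring
      _ < (m : ℝ) ^ δ * Real.log 2 := hlog
      _ ≤ k * Real.log 2 := mul_le_mul_of_nonneg_right hkge hlog2.le
      _ = Real.log 2 * k := by ring
  have h2 : (2 : ℝ) ^ (k : ℝ) ≤ (m.choose k : ℝ) := by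
    rw [Real.rpow_natCast]
    exact_mod_cast Literature.ModelTheory.FiniteModelTheory.two_pow_le_choose_of_two_mul_le h2k
  exact h1.trans_le h2

/-- Polynomially many terms of small affine defect are too few: for `0 < δ' < δ < 1` and every `c`, eventually, for all
`R ≤ m^c` and `p + 1 ≤ m^{δ'}`, `(R+1)^{p+1} < C(m, ⌈m^δ⌉₊)`. [folklore] -/
theorem eventually_pow_succ_lt_choose {δ δ' : ℝ} (hδ0 : 0 < δ) (hδ1 : δ < 1) (hδ'0 : 0 < δ') (hδ' : δ' < δ) (c : ℕ) :
    ∀ᶠ m : ℕ in atTop, ∀ R : ℕ, R ≤ m ^ c → ∀ p : ℕ, (p : ℝ) + 1 ≤ (m : ℝ) ^ δ' →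
      (R + 1) ^ (p + 1) < m.choose ⌈(m : ℝ) ^ δ⌉₊ := by
  filter_upwards [eventually_rpow_mul_rpow_lt_choose hδ0 hδ1 hδ' ((c : ℝ) + 1), eventually_ge_atTop 2] with m hm hm2
  intro R hR p hp
  have hm1 : (1 : ℝ) ≤ m := by exact_mod_cast (show 1 ≤ m by omega)
  have hm0 : (0 : ℝ) < m := by linarith
  -- `(R+1)^{p+1} ≤ (m^{c+1})^{p+1} = m^{(c+1)(p+1)} ≤ m^{(c+1) m^{δ'}}`
  have hR1 : R + 1 ≤ m ^ (c + 1) := by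
    have h1 : m ^ c + 1 ≤ m ^ (c + 1) := by
      rw [pow_succ]
      have : 1 ≤ m ^ c := Nat.one_le_pow _ _ (by omega)
      nlinarith
    exact le_trans (by omega) h1
  have hstep : ((R + 1) ^ (p + 1) : ℝ) ≤ (m : ℝ) ^ (((c : ℝ) + 1) * (m : ℝ) ^ δ') := by
    calc ((R + 1) ^ (p + 1) : ℝ) ≤ ((m : ℝ) ^ (c + 1)) ^ (p + 1) := by
          have : ((R : ℝ) + 1) ≤ (m : ℝ) ^ (c + 1) := by exact_mod_cast hR1
          exact pow_le_pow_left₀ (by positivity) this _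
      _ = (m : ℝ) ^ (((c : ℝ) + 1) * ((p : ℝ) + 1)) := by
          rw [← Real.rpow_natCast, ← Real.rpow_natCast, ← Real.rpow_mul hm0.le]
          push_cast
          ring_nf
      _ ≤ (m : ℝ) ^ (((c : ℝ) + 1) * (m : ℝ) ^ δ') := by
          refine Real.rpow_le_rpow_of_exponent_le hm1 ?_
          exact mul_le_mul_of_nonneg_left hp (by positivity)
  have h := hstep.trans_lt hm
  exact_mod_cast h

/-! ## Eventual forms -/

variable {m : ℕ}

/-- **The LP slice of the crux has no lift-free refutation, every `δ ∈ (0,1)`.** For every `c`, eventually in `m`, for every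
`ε > 0`: no factorisation `cdist Q u − ε = ∑_{l<R} U_l(u) V_l(Q)` with `R ≤ m^c`, `V_l ≥ 0` on `k`-sets (`k = ⌈m^δ⌉₊`) and
AFFINE column objects `U_l(u) = a_l − t_l(u) ≥ 0` on `k`-clique-free graphs. (`affine_terms_lower_bound`: such a
factorisation has `R ≥ C(m,k) > m^c`.) [new] -/
theorem lpSlice_affine_columns {δ : ℝ} (hδ0 : 0 < δ) (hδ1 : δ < 1) (c : ℕ) :
    ∀ᶠ m : ℕ in atTop, ∀ ε : ℝ, 0 < ε → ∀ R : ℕ, R ≤ m ^ c →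
      ∀ (U : (Edge m → Bool) → Fin R → ℝ) (V : Fin R → Finset (Fin m) → ℝ),
      (∀ u l, cliqueFn m ⌈(m : ℝ) ^ δ⌉₊ u = false → 0 ≤ U u l) →
      (∀ l (Q : Finset (Fin m)), Q.card = ⌈(m : ℝ) ^ δ⌉₊ → 0 ≤ V l Q) →
      (∀ l, ∃ (a : ℝ) (t : Edge m → ℝ), ∀ u, cliqueFn m ⌈(m : ℝ) ^ δ⌉₊ u = false →
        U u l = a - ∑ f, (if u f = true then t f else 0)) →
      ¬ ∀ (Q : Finset (Fin m)) (u : Edge m → Bool), Q.card = ⌈(m : ℝ) ^ δ⌉₊ → cliqueFn m ⌈(m : ℝ) ^ δ⌉₊ u = false →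
          cdist Q u - ε = ∑ l, U u l * V l Q := by
  have hδ2 : δ / 2 < δ := by linarith
  filter_upwards [eventually_pow_succ_lt_choose hδ0 hδ1 (by linarith) hδ2 c, eventually_two_mul_ceil_rpow_le hδ0 hδ1,
    eventually_ge_atTop 1] with m hcount hk hm1
  obtain ⟨-, hk3⟩ := hk
  intro ε hε R hR U V hU hV haff hall
  have hlb := affine_terms_lower_bound hk3 U V hU hV haff ε hε hall
  have hlt := hcount R hR 0 (by
    have : (1 : ℝ) ≤ (m : ℝ) ^ (δ / 2) := Real.one_le_rpow (by exact_mod_cast hm1) (by linarith)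
    push_cast; linarith)
  rw [zero_add, pow_one] at hlt
  omega

/-- **Affine codimension, quantitative eventual form.** For `0 < δ' < δ < 1` and every `c`: eventually in `m`, for every
`ε > 0`, every `R ≤ m^c` and every `p` with `p + 1 ≤ m^{δ'}`: no factorisation `cdist Q u − ε = ∑_{l<R} U_l(u) V_l(Q)`
(`U_l ≥ 0` on `k`-clique-free graphs, `V_l ≥ 0` on `k`-sets) whose column objects have affine defect `≤ p` (every `p+1` of
them have a non-trivial combination affine in the graph on clique-free graphs). I.e. the column objects of a polynomial-size
LP refutation span at least `m^{δ'}` directions modulo the affine functions of the graph, every `δ' < δ`. [new] -/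
theorem lpSlice_affine_codim_rpow {δ δ' : ℝ} (hδ0 : 0 < δ) (hδ1 : δ < 1) (hδ'0 : 0 < δ') (hδ' : δ' < δ) (c : ℕ) :
    ∀ᶠ m : ℕ in atTop, ∀ ε : ℝ, 0 < ε → ∀ R : ℕ, R ≤ m ^ c → ∀ p : ℕ, (p : ℝ) + 1 ≤ (m : ℝ) ^ δ' →
      ∀ (U : (Edge m → Bool) → Fin R → ℝ) (V : Fin R → Finset (Fin m) → ℝ),
      (∀ u l, cliqueFn m ⌈(m : ℝ) ^ δ⌉₊ u = false → 0 ≤ U u l) →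
      (∀ l (Q : Finset (Fin m)), Q.card = ⌈(m : ℝ) ^ δ⌉₊ → 0 ≤ V l Q) →
      (∀ s : Finset (Fin R), s.card = p + 1 → ∃ h : Fin R → ℝ, (∀ l, l ∉ s → h l = 0) ∧ h ≠ 0 ∧
        ∃ (a : ℝ) (t : Edge m → ℝ), ∀ u : Edge m → Bool, cliqueFn m ⌈(m : ℝ) ^ δ⌉₊ u = false →
          ∑ l, h l * U u l = a - ∑ f, (if u f = true then t f else 0)) →
      ¬ ∀ (Q : Finset (Fin m)) (u : Edge m → Bool), Q.card = ⌈(m : ℝ) ^ δ⌉₊ → cliqueFn m ⌈(m : ℝ) ^ δ⌉₊ u = false →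
          cdist Q u - ε = ∑ l, U u l * V l Q := by
  filter_upwards [eventually_pow_succ_lt_choose hδ0 hδ1 hδ'0 hδ' c, eventually_two_mul_ceil_rpow_le hδ0 hδ1]
    with m hcount hk
  obtain ⟨-, hk3⟩ := hk
  intro ε hε R hR p hp U V hU hV hP hall
  have hlb := affine_codim_terms_lower_bound hk3 U V hU hV ε hε hall hP
  have hlt := hcount R hR p hp
  omega

/-! ## Polyhedral form: sandwiched polyhedra have `≥ C(m,k)` facets -/

/-- **Facet count of sandwiched polyhedra (fixed `m`).** Let `3 ≤ k`, `ε > 0`, and let `K = {x : t_i·x ≤ a_i, i < R}` be a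
polyhedron in `ℝ^{E(K_m)}` containing every `k`-clique-free graph (each `t_i·x ≤ a_i` is valid on clique-free graphs) and
contained in the `ε`-relaxation `{x : x(E(Q)) ≤ C(k,2) − ε for all k-sets Q}` of the clique constraints. Then `R ≥ C(m,k)`:
the bare clique `1_{E(Q)}` has `x(E(Q)) = C(k,2)`, so it violates some facet, which CATCHES `Q`; by `caught_clique_unique`
distinct cliques violate distinct facets. (Lift-free LP separation of `k`-cliques from `k`-clique-free graphs with margin
needs as many inequalities as there are cliques.) [new] -/
theorem sandwiched_polyhedron_facets_ge_choose {k R : ℕ} (hk : 3 ≤ k) (t : Fin R → Edge m → ℝ) (a : Fin R → ℝ)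
    (hvalid : ∀ i (u : Edge m → Bool), cliqueFn m k u = false → (∑ f, if u f = true then t i f else 0) ≤ a i)
    (ε : ℝ) (hε : 0 < ε)
    (himp : ∀ x : Edge m → ℝ, (∀ i, ∑ f, x f * t i f ≤ a i) →
      ∀ Q : Finset (Fin m), Q.card = k → (∑ f, if cliqueVec Q f = true then x f else 0) ≤ (k.choose 2 : ℝ) - ε) :
    m.choose k ≤ R := by
  classical
  -- every bare clique violates a facet, which catches it
  have hcatch : ∀ Q : Finset (Fin m), Q.card = k → ∃ i, a i < ∑ f ∈ cliqueEdges Q, t i f := by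
    intro Q hQ
    by_contra hcon
    push Not at hcon
    have hx : ∀ i, ∑ f, (if cliqueVec Q f = true then (1 : ℝ) else 0) * t i f ≤ a i := by
      intro i
      have h := hcon i
      rw [sum_cliqueEdges] at h
      refine le_trans (le_of_eq (Finset.sum_congr rfl fun f _ => ?_)) h
      split_ifs <;> simp
    have h := himp (fun f => if cliqueVec Q f = true then (1 : ℝ) else 0) hx Q hQ
    have hsum : (∑ f, if cliqueVec Q f = true then (if cliqueVec Q f = true then (1 : ℝ) else 0) else 0) =
        (k.choose 2 : ℝ) := by
      rw [← hQ, ← sum_ite_cliqueVec_eq_choose Q]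
      exact Finset.sum_congr rfl fun f _ => by split_ifs <;> rfl
    rw [hsum] at h
    linarith
  choose φ hφ using hcatch
  set S := (Finset.univ : Finset (Fin m)).powersetCard k with hS
  have hmemS : ∀ Q : S, (Q : Finset (Fin m)).card = k := fun Q => (Finset.mem_powersetCard.1 Q.2).2
  set ψ : S → Fin R := fun Q => φ Q.1 (hmemS Q) with hψ
  have hinj : Function.Injective ψ := by
    intro Q₁ Q₂ h
    apply Subtype.ext
    have h1 := hφ Q₁.1 (hmemS Q₁)
    have h2 := hφ Q₂.1 (hmemS Q₂)
    rw [show φ Q₂.1 (hmemS Q₂) = ψ Q₂ from rfl, ← h] at h2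
    exact caught_clique_unique hk (t (ψ Q₁)) (a (ψ Q₁)) (hvalid (ψ Q₁)) (hmemS Q₁) (hmemS Q₂) h1 h2
  have hcard := Fintype.card_le_of_injective ψ hinj
  rw [Fintype.card_coe, hS, Finset.card_powersetCard, Finset.card_univ, Fintype.card_fin, Fintype.card_fin] at hcard
  exact hcard

/-- **No small sandwiched polyhedron, every `δ ∈ (0,1)`.** For every `c`, eventually in `m`, for every `ε > 0` and every
`R ≤ m^c`: no polyhedron with `R` inequalities, all valid on `k`-clique-free graphs (`k = ⌈m^δ⌉₊`), is contained in the
`ε`-relaxation of the clique constraints. [new] -/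
theorem lpSlice_no_sandwiched_polyhedron {δ : ℝ} (hδ0 : 0 < δ) (hδ1 : δ < 1) (c : ℕ) :
    ∀ᶠ m : ℕ in atTop, ∀ ε : ℝ, 0 < ε → ∀ R : ℕ, R ≤ m ^ c → ∀ (t : Fin R → Edge m → ℝ) (a : Fin R → ℝ),
      (∀ i (u : Edge m → Bool), cliqueFn m ⌈(m : ℝ) ^ δ⌉₊ u = false → (∑ f, if u f = true then t i f else 0) ≤ a i) →
      ¬ ∀ x : Edge m → ℝ, (∀ i, ∑ f, x f * t i f ≤ a i) →
        ∀ Q : Finset (Fin m), Q.card = ⌈(m : ℝ) ^ δ⌉₊ →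
          (∑ f, if cliqueVec Q f = true then x f else 0) ≤ ((⌈(m : ℝ) ^ δ⌉₊).choose 2 : ℝ) - ε := by
  have hδ2 : δ / 2 < δ := by linarith
  filter_upwards [eventually_pow_succ_lt_choose hδ0 hδ1 (by linarith) hδ2 c, eventually_two_mul_ceil_rpow_le hδ0 hδ1,
    eventually_ge_atTop 1] with m hcount hk hm1
  obtain ⟨-, hk3⟩ := hk
  intro ε hε R hR t a hvalid himp
  have hlb := sandwiched_polyhedron_facets_ge_choose hk3 t a hvalid ε hε himp
  have hlt := hcount R hR 0 (by
    have : (1 : ℝ) ≤ (m : ℝ) ^ (δ / 2) := Real.one_le_rpow (by exact_mod_cast hm1) (by linarith)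
    push_cast; linarith)
  rw [zero_add, pow_one] at hlt
  omega

/-! ## Registered forms -/

/-- **No lift-free LP refutation of the crux, every `δ ∈ (0,1)`** (registered form of `lpSlice_affine_columns`). [new] -/
theorem lpSlice_affine_columns_blind : ∀ (δ : ℝ), 0 < δ → δ < 1 → ∀ c : ℕ, ∀ᶠ m : ℕ in Filter.atTop, ∀ ε : ℝ, 0 < ε → ∀ R : ℕ, R ≤ m ^ c → ∀ (U : (Edge m → Bool) → Fin R → ℝ) (V : Fin R → Finset (Fin m) → ℝ), (∀ u l, cliqueFn m ⌈(m : ℝ) ^ δ⌉₊ u = false → 0 ≤ U u l) → (∀ l (Q : Finset (Fin m)), Q.card = ⌈(m : ℝ) ^ δ⌉₊ → 0 ≤ V l Q) → (∀ l, ∃ (a : ℝ) (t : Edge m → ℝ), ∀ u, cliqueFn m ⌈(m : ℝ) ^ δ⌉₊ u = false → U u l = a - ∑ f, (if u f = true then t f else 0)) → ¬ ∀ (Q : Finset (Fin m)) (u : Edge m → Bool), Q.card = ⌈(m : ℝ) ^ δ⌉₊ → cliqueFn m ⌈(m : ℝ) ^ δ⌉₊ u = false → cdist Q u - ε = ∑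 l, U u l * V l Q :=
  fun _ hδ0 hδ1 c => lpSlice_affine_columns hδ0 hδ1 c

/-- **Affine defect `≥ m^{δ'}` for every `δ' < δ`** (registered form of `lpSlice_affine_codim_rpow`). [new] -/
theorem lpSlice_affine_codimension_rpow : ∀ (δ δ' : ℝ), 0 < δ → δ < 1 → 0 < δ' → δ' < δ → ∀ c : ℕ, ∀ᶠ m : ℕ in Filter.atTop, ∀ ε : ℝ, 0 < ε → ∀ R : ℕ, R ≤ m ^ c → ∀ p : ℕ, (p : ℝ) + 1 ≤ (m : ℝ) ^ δ' → ∀ (U : (Edge m → Bool) → Fin R → ℝ) (V : Fin R → Finset (Fin m) → ℝ), (∀ u l, cliqueFn m ⌈(m : ℝ) ^ δ⌉₊ u = false → 0 ≤ U u l) → (∀ l (Q : Finset (Fin m)), Q.card = ⌈(m : ℝ) ^ δ⌉₊ → 0 ≤ V l Q) → (∀ s : Finset (Fin R), s.card = p + 1 → ∃ h : Fin R → ℝ, (∀ l, l ∉ s → h l = 0) ∧ h ≠ 0 ∧ ∃ (a : ℝ) (t : Edge m → ℝ), ∀ u : Edge m → Bool, cliqueFn m ⌈(m : ℝ) ^ δ⌉₊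 u = false → ∑ l, h l * U u l = a - ∑ f, (if u f = true then t f else 0)) → ¬ ∀ (Q : Finset (Fin m)) (u : Edge m → Bool), Q.card = ⌈(m : ℝ) ^ δ⌉₊ → cliqueFn m ⌈(m : ℝ) ^ δ⌉₊ u = false → cdist Q u - ε = ∑ l, U u l * V l Q :=
  fun _ _ hδ0 hδ1 hδ'0 hδ' c => lpSlice_affine_codim_rpow hδ0 hδ1 hδ'0 hδ' c

/-- **Sandwiched polyhedra have `≥ C(m,k)` facets** (registered form of `sandwiched_polyhedron_facets_ge_choose`). [new] -/
theorem sandwiched_polyhedron_facets : ∀ {m k R : ℕ}, 3 ≤ k → ∀ (t : Fin R → Edge m → ℝ) (a : Fin R → ℝ), (∀ i (u : Edge m → Bool), cliqueFn m k u = false → (∑ f, if u f = true then t i f else 0) ≤ a i) → ∀ (ε : ℝ), 0 < ε → (∀ x : Edge m → ℝ, (∀ i, ∑ f, x f * t i f ≤ a i) → ∀ Q : Finset (Fin m), Q.card = k → (∑ f, if cliqueVec Q f = true then x f else 0) ≤ (k.choose 2 : ℝ) - ε) → m.choose k ≤ R :=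
  fun hk t a hvalid ε hε himp => sandwiched_polyhedron_facets_ge_choose hk t a hvalid ε hε himp

/-- **No small sandwiched polyhedron, every `δ ∈ (0,1)`** (registered form of `lpSlice_no_sandwiched_polyhedron`). [new] -/
theorem lpSlice_no_small_sandwiched_polyhedron : ∀ (δ : ℝ), 0 < δ → δ < 1 → ∀ c : ℕ, ∀ᶠ m : ℕ in Filter.atTop, ∀ ε : ℝ, 0 < ε → ∀ R : ℕ, R ≤ m ^ c → ∀ (t : Fin R → Edge m → ℝ) (a : Fin R → ℝ), (∀ i (u : Edge m → Bool), cliqueFn m ⌈(m : ℝ) ^ δ⌉₊ u = false → (∑ f, if u f = true then t i f else 0) ≤ a i) → ¬ ∀ x : Edge m → ℝ, (∀ i, ∑ f, x f * t i f ≤ a i) → ∀ Q : Finset (Fin m), Q.card = ⌈(m : ℝ) ^ δ⌉₊ → (∑ f, if cliqueVec Q f = true then x f else 0) ≤ ((⌈(m : ℝ) ^ δ⌉₊).choose 2 : ℝ) - ε :=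
  fun _ hδ0 hδ1 c => lpSlice_no_sandwiched_polyhedron hδ0 hδ1 c

end

end Summit.PneNP.PneNP.Theorems
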